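import Summits.HubbardSuperconductivity.HubbardSuperconductivity.Theorems.KLProgrammeKLRegimeFlowReadScaleZeroSunsetCertRowsInnerGapRecords

/-!
# Route `KLProgramme`, crux K3 — engine-flow child (stmt-HubbardSuperconductivity-20437), stub (C) at `n = 0`, located item #22a «(C)-SCALE0-PT2»:
# THE WINDOW INSTANTIATION IN SEGMENTS — sub-window one-call + append glue (production shape: N independent record files + one short assembly)

Seat hubbard-kl-k3c5-p1 (g19; owner of #22a).  `…SunsetCertRowsInnerGapRecords.sunsetRows_window_innerGap_of_chain` (p715778) takes ONE list of bundles
chain-covering the whole window `klWindowC = [-21/20, -3/20]`; the near records of format (α) are ≈ 3.7·10³ μ-cells (A2-DESIGN-alpha §4), too many for one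
literal list elaborated in one file.  This file splits the instantiation:
* §1 generic glue — `exists_mem_append_of_Icc_split` (a cover of `[a, m]` from `l₁` and of `[m, b]` from `l₂` give a cover of `[a, b]` from `l₁ ++ l₂`,
  for ANY per-element conclusion `Q x μ`), `forall_klWindowC_of_rat` (rational ends `-21/20`, `-3/20` ⇒ `∀ μ ∈ klWindowC`), `mem_klWindowC_of_rat_Icc`
  (a rational sub-interval of the window lies in the window);
* §2 **`sunsetRows_segment_innerGap_of_chain`** — the one-call on a SUB-WINDOW `[lo, hi] ⊆ klWindowC` (`-21/20 ≤ lo`, `hi ≤ -3/20`, both decidable on literals)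
  from a list of bundles chain-covering `[lo, hi]` (`exists_mem_cell_of_chain`), each with its near certificate, INNER far-gap certificate, the far-sup certificate
  and `SideOK3 rs ω₁ u₀ u₂` — same conclusion as the window theorem (`∃ b ∈ l`, `μ ∈ cell b`, rows `hS0`/`hSk` with `bS := b.bSℝ`), at every real `μ ∈ [lo, hi]`;
* §3 **`sunsetRows_window_innerGap_of_two_segments`** — the worked template: two segment files meeting at a rational `m` give the rows at every `μ ∈ klWindowC`
  from `l₁ ++ l₂`; N segments nest `exists_mem_append_of_Icc_split` N − 1 times and finish with `forall_klWindowC_of_rat` (recipe in the theorem's docstring).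
PRODUCTION RECIPE (per segment file, generated from the kit's record JSON): `def seg_i : List SunsetCellBundle := [...]` (≈ 250 literal bundles), then
`theorem seg_i_rows := sunsetRows_segment_innerGap_of_chain seg_i rs ω₁ u₀ u₂ lo_i hi_i (by norm_num) (by norm_num) (by simp) (by simp [seg_i]; norm_num)
(by simp [seg_i]; norm_num) (by simp only [seg_i, List.map, List.isChain_cons_cons, …]; norm_num) hc hr hrs (by <SideOK3 recipe of p715778 per bundle>)`, with the
three certificate hypotheses `hc hr hrs` carried as named hypotheses (kit-discharged, D-0022 lane); the assembly file imports the segment files and glues.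
Proofs only (no definitions); the certificates are HYPOTHESES; nothing here asserts (C), any stub of 20437, K3, the margin or superconductivity.
References: BGM 2006 §2.3 (2.17)–(2.20), §2.4 [cite: BenfattoGiulianiMastropietro2006].
-/

noncomputable section

namespace Summit.HubbardSuperconductivity.HubbardSuperconductivity.Theorems.KLRegimeSplit

set_option linter.dupNamespace false -- summit = problem name (single-conjunct summit), D-0017

open Literature.MathematicalPhysics.QuantumLattice Literature.Probability.LatticeModels Literature.Analysis.FunctionSpaces
open Summit.HubbardSuperconductivity.HubbardSuperconductivity.Theorems.DispersionFlow
open Summit.HubbardSuperconductivity.HubbardSuperconductivity.Theorems.EngineV8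
open MeasureTheory Set Finset Complex UnitAddTorus Real GrassmannAlgebra Matrix
open scoped FourierTransform Nat ENNReal NNReal

/-! ## §1 Generic glue -/

/-- **Append glue**: if every real `μ ∈ [a, m]` is served by some element of `l₁` and every `μ ∈ [m, b]` by some element of `l₂` (same per-element conclusion `Q`),
then every `μ ∈ [a, b]` is served by some element of `l₁ ++ l₂`. [folklore] -/
theorem exists_mem_append_of_Icc_split {α : Type*} (Q : α → ℝ → Prop) (l₁ l₂ : List α) (a m b : ℚ)
    (h₁ : ∀ μ : ℝ, (a : ℝ) ≤ μ → μ ≤ (m : ℝ) → ∃ x ∈ l₁, Q x μ)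
    (h₂ : ∀ μ : ℝ, (m : ℝ) ≤ μ → μ ≤ (b : ℝ) → ∃ x ∈ l₂, Q x μ) :
    ∀ μ : ℝ, (a : ℝ) ≤ μ → μ ≤ (b : ℝ) → ∃ x ∈ l₁ ++ l₂, Q x μ := by
  intro μ ha hb
  rcases le_total μ (m : ℝ) with hm | hm
  · obtain ⟨x, hx, hQ⟩ := h₁ μ ha hm
    exact ⟨x, List.mem_append.2 (Or.inl hx), hQ⟩
  · obtain ⟨x, hx, hQ⟩ := h₂ μ hm hb
    exact ⟨x, List.mem_append.2 (Or.inr hx), hQ⟩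

/-- **Window ends**: a statement at every real `μ` between the rational ends `-21/20` and `-3/20` holds at every `μ ∈ klWindowC`. [folklore] -/
theorem forall_klWindowC_of_rat {Q : ℝ → Prop}
    (h : ∀ μ : ℝ, ((((-21) / 20 : ℚ)) : ℝ) ≤ μ → μ ≤ ((((-3) / 20 : ℚ)) : ℝ) → Q μ) : ∀ μ ∈ klWindowC, Q μ := by
  intro μ hμ
  obtain ⟨h1, h2⟩ := (mem_klWindowC_iff_rat μ).1 hμ
  exact h μ h1 h2

/-- **Sub-windows**: a rational interval `[lo, hi]` with `-21/20 ≤ lo`, `hi ≤ -3/20` lies in `klWindowC`. [folklore] -/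
theorem mem_klWindowC_of_rat_Icc {lo hi : ℚ} (hlo : (-21) / 20 ≤ lo) (hhi : hi ≤ (-3) / 20) {μ : ℝ}
    (h1 : (lo : ℝ) ≤ μ) (h2 : μ ≤ (hi : ℝ)) : μ ∈ klWindowC := by
  rw [mem_klWindowC_iff_rat]
  exact ⟨le_trans (by exact_mod_cast hlo) h1, le_trans h2 (by exact_mod_cast hhi)⟩

/-! ## §2 The one-call on a sub-window -/

section Segment

variable {L M : ℕ} [NeZero L]

/-- **THE CERTIFIED SUNSET ROWS ON A SUB-WINDOW `[lo, hi] ⊆ klWindowC`, INNER-GAP FORMAT — decidable cover form**: from a list of bundles chain-covering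
`[lo, hi]` (`exists_mem_cell_of_chain` on `l.map (fun b => (b.c.μlo, b.c.μhi))`), each with its near certificate, INNER far-gap certificate, the far-sup certificate
and `SideOK3 rs ω₁ u₀ u₂`: at every real `μ ∈ [lo, hi]` some bundle contains `μ` and delivers `hS0`/`hSk` with `bS := b.bSℝ`.  One segment = one record file.
[cite: BenfattoGiulianiMastropietro2006, §2.3-§2.4] -/
theorem sunsetRows_segment_innerGap_of_chain [NeZero M] (l : List SunsetCellBundle) (rs : SunsetFarSupRecord) (ω₁ u₀ u₂ lo hi : ℚ)
    (hlo : (-21) / 20 ≤ lo) (hhi : hi ≤ (-3) / 20)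
    (hne : l.map (fun b => (b.c.μlo, b.c.μhi)) ≠ [])
    (hhead : ∀ c ∈ (l.map (fun b => (b.c.μlo, b.c.μhi))).head?, c.1 ≤ lo)
    (hlast : ∀ c ∈ (l.map (fun b => (b.c.μlo, b.c.μhi))).getLast?, hi ≤ c.2)
    (hchain : (l.map (fun b => (b.c.μlo, b.c.μhi))).IsChain (fun c d => d.1 ≤ c.2))
    (hc : ∀ b ∈ l, ScaleZeroSunsetCertV3 b.c) (hr : ∀ b ∈ l, ScaleZeroFarGapCert b.c.toSunsetCellRecordV2 b.r)
    (hrs : ∀ b ∈ l, ScaleZeroFarSupCert b.c.toSunsetCellRecordV2 rs) (hside : ∀ b ∈ l, b.SideOK3 rs ω₁ u₀ u₂)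
    {β U : ℝ} (hβ : klBetaMin ≤ β) (hU0 : 0 < U) (hU : U ≤ (2 : ℝ)⁻¹ ^ 20) (hL3 : klEngL₃ β U ≤ L) (hM3 : klEngM₃ β U L ≤ M) :
    ∀ μ : ℝ, (lo : ℝ) ≤ μ → μ ≤ (hi : ℝ) → ∃ b ∈ l, ((b.c.μlo : ℝ) ≤ μ ∧ μ ≤ b.c.μhi) ∧
    (∀ (σ : Fin 2) (p₀ : GridPoint L (2 * (2 * M))), ∑ p₁ : GridPoint L (2 * (2 * M)),
      (if p₁ = p₀ then (0 : ℝ) else (if p₁.2 - p₀.2 = 0 then (0 : ℝ) else 1) * ‖contr ℂ ((hubbardGridSub L M β (2 * (2 * M))).transpose * hubbardCovAboveCT L M β μ 0 0 klE0 *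
                hubbardGridSub L M β (2 * (2 * M))) (((p₁, σ), 0) : GridLeg (GridPoint L (2 * (2 * M)))) ((p₀, σ), 1) *
              (contr ℂ ((hubbardGridSub L M β (2 * (2 * M))).transpose * hubbardCovAboveCT L M β μ 0 0 klE0 *
                hubbardGridSub L M β (2 * (2 * M))) (((p₀, σ.rev), 0) : GridLeg (GridPoint L (2 * (2 * M)))) ((p₁, σ.rev), 1) *
                contr ℂ ((hubbardGridSub L M β (2 * (2 * M))).transpose * hubbardCovAboveCT L M β μ 0 0 klE0 *
                hubbardGridSub L M β (2 * (2 * M))) (((p₁, σ.rev), 0) : GridLeg (GridPoint L (2 * (2 * M)))) ((p₀, σ.rev), 1))‖) ≤ b.bSℝ 0 * (((2 * (2 * M) : ℕ) : ℝ) / β)) ∧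
    (∀ k, 1 ≤ k → k ≤ 2 → ∀ (σ : Fin 2) (p₀ : GridPoint L (2 * (2 * M))), ∑ p₁ : GridPoint L (2 * (2 * M)),
      (if p₁ = p₀ then (0 : ℝ) else
        Real.sqrt ((((p₁.2 - p₀.2) 0).valMinAbs.natAbs : ℝ) ^ 2 + (((p₁.2 - p₀.2) 1).valMinAbs.natAbs : ℝ) ^ 2) ^ k * ‖contr ℂ ((hubbardGridSub L M β (2 * (2 * M))).transpose * hubbardCovAboveCT L M β μ 0 0 klE0 *
                hubbardGridSub L M β (2 * (2 * M))) (((p₁, σ), 0) : GridLeg (GridPoint L (2 * (2 * M)))) ((p₀, σ), 1) *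
              (contr ℂ ((hubbardGridSub L M β (2 * (2 * M))).transpose * hubbardCovAboveCT L M β μ 0 0 klE0 *
                hubbardGridSub L M β (2 * (2 * M))) (((p₀, σ.rev), 0) : GridLeg (GridPoint L (2 * (2 * M)))) ((p₁, σ.rev), 1) *
                contr ℂ ((hubbardGridSub L M β (2 * (2 * M))).transpose * hubbardCovAboveCT L M β μ 0 0 klE0 *
                hubbardGridSub L M β (2 * (2 * M))) (((p₁, σ.rev), 0) : GridLeg (GridPoint L (2 * (2 * M)))) ((p₀, σ.rev), 1))‖) ≤
        b.bSℝ k * (((2 * (2 * M) : ℕ) : ℝ) / β)) := by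
  intro μ h1 h2
  have hμ : μ ∈ klWindowC := mem_klWindowC_of_rat_Icc hlo hhi h1 h2
  obtain ⟨cc, hcc, h1', h2'⟩ := exists_mem_cell_of_chain _ _ _ hne hhead hlast hchain μ h1 h2
  obtain ⟨b, hb, rfl⟩ := List.mem_map.1 hcc
  exact ⟨b, hb, ⟨h1', h2'⟩, sunsetRows_of_bundle_innerGap (L := L) (M := M) b rs ω₁ u₀ u₂ (hc b hb) (hr b hb) (hrs b hb) (hside b hb)
    hμ h1' h2' hβ hU0 hU hL3 hM3⟩

end Segment

/-! ## §3 Two segments glued — the template of the production assembly -/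

section TwoSegments

variable {L M : ℕ} [NeZero L]

/-- **THE CERTIFIED SUNSET ROWS AT EVERY `μ ∈ klWindowC` FROM TWO SEGMENTS** meeting at a rational `m`: segment 1 chain-covers `[-21/20, m]`, segment 2
chain-covers `[m, -3/20]`; at every `μ ∈ klWindowC` some bundle of `l₁ ++ l₂` contains `μ` and delivers `hS0`/`hSk`.  RECIPE for N segments with junctions
`-21/20 = m₀ ≤ m₁ ≤ … ≤ m_N = -3/20`: `forall_klWindowC_of_rat (exists_mem_append_of_Icc_split Q l₁ (l₂ ++ …) m₀ m₁ m_N seg₁ (exists_mem_append_of_Icc_split Q l₂ (…)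
m₁ m₂ m_N seg₂ (… seg_N)))` with `Q b μ := (μ ∈ cell b) ∧ rows b μ` and `seg_i := sunsetRows_segment_innerGap_of_chain l_i … m_{i-1} m_i …` — exactly this proof.
[cite: BenfattoGiulianiMastropietro2006, §2.3-§2.4] -/
theorem sunsetRows_window_innerGap_of_two_segments [NeZero M] (l₁ l₂ : List SunsetCellBundle) (rs : SunsetFarSupRecord) (ω₁ u₀ u₂ m : ℚ)
    (hm₁ : (-21) / 20 ≤ m) (hm₂ : m ≤ (-3) / 20)
    (hne₁ : l₁.map (fun b => (b.c.μlo, b.c.μhi)) ≠ [])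
    (hhead₁ : ∀ c ∈ (l₁.map (fun b => (b.c.μlo, b.c.μhi))).head?, c.1 ≤ (-21) / 20)
    (hlast₁ : ∀ c ∈ (l₁.map (fun b => (b.c.μlo, b.c.μhi))).getLast?, m ≤ c.2)
    (hchain₁ : (l₁.map (fun b => (b.c.μlo, b.c.μhi))).IsChain (fun c d => d.1 ≤ c.2))
    (hne₂ : l₂.map (fun b => (b.c.μlo, b.c.μhi)) ≠ [])
    (hhead₂ : ∀ c ∈ (l₂.map (fun b => (b.c.μlo, b.c.μhi))).head?, c.1 ≤ m)
    (hlast₂ : ∀ c ∈ (l₂.map (fun b => (b.c.μlo, b.c.μhi))).getLast?, (-3) / 20 ≤ c.2)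
    (hchain₂ : (l₂.map (fun b => (b.c.μlo, b.c.μhi))).IsChain (fun c d => d.1 ≤ c.2))
    (hc : ∀ b ∈ l₁ ++ l₂, ScaleZeroSunsetCertV3 b.c) (hr : ∀ b ∈ l₁ ++ l₂, ScaleZeroFarGapCert b.c.toSunsetCellRecordV2 b.r)
    (hrs : ∀ b ∈ l₁ ++ l₂, ScaleZeroFarSupCert b.c.toSunsetCellRecordV2 rs) (hside : ∀ b ∈ l₁ ++ l₂, b.SideOK3 rs ω₁ u₀ u₂)
    {μ β U : ℝ} (hμ : μ ∈ klWindowC)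
    (hβ : klBetaMin ≤ β) (hU0 : 0 < U) (hU : U ≤ (2 : ℝ)⁻¹ ^ 20) (hL3 : klEngL₃ β U ≤ L) (hM3 : klEngM₃ β U L ≤ M) :
    ∃ b ∈ l₁ ++ l₂, ((b.c.μlo : ℝ) ≤ μ ∧ μ ≤ b.c.μhi) ∧
    (∀ (σ : Fin 2) (p₀ : GridPoint L (2 * (2 * M))), ∑ p₁ : GridPoint L (2 * (2 * M)),
      (if p₁ = p₀ then (0 : ℝ) else (if p₁.2 - p₀.2 = 0 then (0 : ℝ) else 1) * ‖contr ℂ ((hubbardGridSub L M β (2 * (2 * M))).transpose * hubbardCovAboveCT L M β μ 0 0 klE0 *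
                hubbardGridSub L M β (2 * (2 * M))) (((p₁, σ), 0) : GridLeg (GridPoint L (2 * (2 * M)))) ((p₀, σ), 1) *
              (contr ℂ ((hubbardGridSub L M β (2 * (2 * M))).transpose * hubbardCovAboveCT L M β μ 0 0 klE0 *
                hubbardGridSub L M β (2 * (2 * M))) (((p₀, σ.rev), 0) : GridLeg (GridPoint L (2 * (2 * M)))) ((p₁, σ.rev), 1) *
                contr ℂ ((hubbardGridSub L M β (2 * (2 * M))).transpose * hubbardCovAboveCT L M β μ 0 0 klE0 *
                hubbardGridSub L M β (2 * (2 * M))) (((p₁, σ.rev), 0) : GridLeg (GridPoint L (2 * (2 * M)))) ((p₀, σ.rev), 1))‖) ≤ b.bSℝ 0 * (((2 * (2 * M) : ℕ) : ℝ) / β)) ∧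
    (∀ k, 1 ≤ k → k ≤ 2 → ∀ (σ : Fin 2) (p₀ : GridPoint L (2 * (2 * M))), ∑ p₁ : GridPoint L (2 * (2 * M)),
      (if p₁ = p₀ then (0 : ℝ) else
        Real.sqrt ((((p₁.2 - p₀.2) 0).valMinAbs.natAbs : ℝ) ^ 2 + (((p₁.2 - p₀.2) 1).valMinAbs.natAbs : ℝ) ^ 2) ^ k * ‖contr ℂ ((hubbardGridSub L M β (2 * (2 * M))).transpose * hubbardCovAboveCT L M β μ 0 0 klE0 *
                hubbardGridSub L M β (2 * (2 * M))) (((p₁, σ), 0) : GridLeg (GridPoint L (2 * (2 * M)))) ((p₀, σ), 1) *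
              (contr ℂ ((hubbardGridSub L M β (2 * (2 * M))).transpose * hubbardCovAboveCT L M β μ 0 0 klE0 *
                hubbardGridSub L M β (2 * (2 * M))) (((p₀, σ.rev), 0) : GridLeg (GridPoint L (2 * (2 * M)))) ((p₁, σ.rev), 1) *
                contr ℂ ((hubbardGridSub L M β (2 * (2 * M))).transpose * hubbardCovAboveCT L M β μ 0 0 klE0 *
                hubbardGridSub L M β (2 * (2 * M))) (((p₁, σ.rev), 0) : GridLeg (GridPoint L (2 * (2 * M)))) ((p₀, σ.rev), 1))‖) ≤
        b.bSℝ k * (((2 * (2 * M) : ℕ) : ℝ) / β)) := by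
  have hl₁ : ∀ b ∈ l₁, b ∈ l₁ ++ l₂ := fun b hb => List.mem_append.2 (Or.inl hb)
  have hl₂ : ∀ b ∈ l₂, b ∈ l₁ ++ l₂ := fun b hb => List.mem_append.2 (Or.inr hb)
  have seg₁ := sunsetRows_segment_innerGap_of_chain (L := L) (M := M) l₁ rs ω₁ u₀ u₂ ((-21) / 20) m le_rfl hm₂ hne₁ hhead₁ hlast₁ hchain₁
    (fun b hb => hc b (hl₁ b hb)) (fun b hb => hr b (hl₁ b hb)) (fun b hb => hrs b (hl₁ b hb)) (fun b hb => hside b (hl₁ b hb)) hβ hU0 hU hL3 hM3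
  have seg₂ := sunsetRows_segment_innerGap_of_chain (L := L) (M := M) l₂ rs ω₁ u₀ u₂ m ((-3) / 20) hm₁ le_rfl hne₂ hhead₂ hlast₂ hchain₂
    (fun b hb => hc b (hl₂ b hb)) (fun b hb => hr b (hl₂ b hb)) (fun b hb => hrs b (hl₂ b hb)) (fun b hb => hside b (hl₂ b hb)) hβ hU0 hU hL3 hM3
  exact forall_klWindowC_of_rat (exists_mem_append_of_Icc_split _ l₁ l₂ ((-21) / 20) m ((-3) / 20) seg₁ seg₂) μ hμ

end TwoSegments

end Summit.HubbardSuperconductivity.HubbardSuperconductivity.Theorems.KLRegimeSplit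

end
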